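import Mathlib
import Summits.Ventures.PercRepro2.Defs
import Summits.Ventures.PercRepro2.Independence
import Summits.Ventures.PercRepro2.Harris
import Summits.Ventures.PercRepro2.Graph
import Summits.Ventures.PercRepro2.Exploration
import Summits.Ventures.PercRepro2.Events
import Summits.Ventures.PercRepro2.FourFunctions
import Summits.Ventures.PercRepro2.Induced
import Summits.Ventures.PercRepro2.Frontier
import Summits.Ventures.PercRepro2.ObsIndependence
import Summits.Ventures.PercRepro2.BHK
import Summits.Ventures.PercRepro2.BHKEvents
import Summits.Ventures.PercRepro2.VdBKahn
import Summits.Ventures.PercRepro2.BHKAvoid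
import Summits.Ventures.PercRepro2.R2PrimeThreeReduction
import Summits.Ventures.PercRepro2.YBridge
import Summits.Ventures.PercRepro2.Yu1Functionals
import Summits.Ventures.PercRepro2.Yu1Events
import Summits.Ventures.PercRepro2.Yu1
import Summits.Ventures.PercRepro2.LBSplit
import Summits.Ventures.PercRepro2.YDelta
import Summits.Ventures.PercRepro2.YDeltaTools
import Summits.Ventures.PercRepro2.SD
import Summits.Ventures.PercRepro2.Lambda
import Summits.Ventures.PercRepro2.LambdaTau
import Summits.Ventures.PercRepro2.LambdaSlack
import Summits.Ventures.PercRepro2.ZDelta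
import Summits.Ventures.PercRepro2.ZExpand

/-!
# Light-first exploration coordinates for `Z = C + D · (Δ_h − K)` (blind cell PercRepro2, typer-1;
mine-2 `proofs/MINE2-JLEMMA.md` §23 (12), lead g8 ask 2026-08-23T02:57:32Z)

Light-first exploration: `S = C(a₁)` (the light cluster) on `R = avoidAll a₁ {a₂, a₃}`; in the
residual graph `G ∖ S` the heavy root `a₂` has the functionals of `Yu1Functionals` / `SD`:
`u(S) = P_{G∖S}(a₃ ∉ C(a₂))`, `β(S) = P_{G∖S}(b ∈ C(a₂))`, `ψ(S) = β(S) − 1_b(S)(1 − u(S))`, and now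
`q_o(S) = P_{G∖S}(o ∈ C(a₂), a₃ ∉ C(a₂))` (`Yu1.q` with `b := o`).  The new local coordinates are

* `eta` — `η(S) = q_o(S) / u(S) = P_{G∖S}(o ∈ C(a₂) ∣ a₃ ∉ C(a₂))`, the **local heavy share of `o`**
  (mine-2's factor `1{o ∉ S}` is automatic: `eta_eq_zero_of_mem`);
* `sShare` — `s(S) = 1_o(S) + η(S)`, the **local o-root-share**
  (`= P(o ∈ C₁ ∪ C₂ ∣ PD, C₁ = S)` when `u(S) ≠ 0`);
* `rRatio` — `r(S) = ψ(S) / u(S)`, the **local margin ratio**.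

With `D = P(PD) = E[u; R]`, `D_o = P(PD, o ∈ C₁) + P(PD, o ∈ C₂) = E[u s; R]` (`expect_u_sShare`)
and `W = M₂ + Δ_T = E[ψ; R]` (`= E[u r; R]` when `u ≠ 0` on `R`, `expect_u_rRatio`):

* **`Cterm`** `C := D_o · W − D · E[s ψ; R]` — the single Chebyshev/covariance term (when `u ≠ 0` on
  `R` it is mine-2's moment form `E[u s] E[u r] − E[u] E[u s r] = −D² · Cov_P̃(s, r)` under the
  PD-law `P̃` of the light cluster: `LightFirstZ.Cterm_eq_moments`);
* **`Kterm`** `K := E[η · (1_b − 1_{b ∉ ·} β); R]` — the weighted labelling deficit.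

Tower identities `tower_PDoH` (`P(PD, o ∈ C₂) = E[q_o; R]`), `tower_Thl` (`T_{h→l} = E[1_b q_o; R]`)
and `Xl_eq_expect` (`T_{l→h} − Δ_l = E[1_o ψ; R]`); pointwise facts `0 ≤ q_o ≤ u`, `u · η = q_o`
(also when `u = 0`, so the Lean convention `x / 0 = 0` is consistent), `u · r = ψ` (`u ≠ 0`),
`u · s = 1_o u + q_o`.  The identity `Z = C + D · (Δ_h − K)` itself and `Z_0 + Z_h = C − D · K` are in
`LightFirstZ.lean`.  Identities only (NEG-39, lead g8 03:11:11Z / 03:16:54Z): neither `C` nor the payer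
`Δ_h − K` is sign-definite in any class (engine D33: payer 8 violations at n = 5, 128 at n = 6 of which
4 with `a₃ = argmin`; `C < 0` on 4.5 %; `K ≤ 0` false from n = 6), and the two negatives never
coincide — the decomposition is an exact reformulation, not a lemma ladder; no row is typed here.
-/

namespace Summit.Ventures.PercRepro2

open UnionCluster Yu1

namespace LightFirst

section Defs

variable {V : Type*} {E : Type*} [Fintype E] [DecidableEq E] [Fintype V] [DecidableEq V]
  {R : Type*} [Field R] [LinearOrder R] [IsStrictOrderedRing R]

/-- `η(S) = q_o(S) / u(S) = P_{G∖S}(o ∈ C(a₂) ∣ a₃ ∉ C(a₂))`: the local heavy share of `o` after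
exploring the light cluster `S` (`0` when `u(S) = 0`, where also `q_o(S) = 0`). -/
noncomputable def eta (p : E → R) (ends : E → Sym2 V) (o a₂ a₃ : V) : Set V → R :=
  fun S => q p ends a₂ a₃ o S / u p ends a₂ a₃ S

/-- `s(S) = 1_o(S) + η(S)`: the local o-root-share. -/
noncomputable def sShare (p : E → R) (ends : E → Sym2 V) (o a₂ a₃ : V) : Set V → R :=
  fun S => ind o S + eta p ends o a₂ a₃ S

/-- `r(S) = ψ(S) / u(S)`: the local margin ratio. -/
noncomputable def rRatio (p : E → R) (ends : E → Sym2 V) (a₂ a₃ b : V) : Set V → R :=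
  fun S => psi p ends a₂ a₃ b S / u p ends a₂ a₃ S

/-- **`C`** `:= D_o · W − D · E[s(C₁) ψ(C₁); R]` (`= E[u s] E[u r] − E[u] E[u s r]` when `u ≠ 0` on
`R`: `Cterm_eq_moments`). -/
noncomputable def Cterm (p : E → R) (ends : E → Sym2 V) (o a₁ a₂ a₃ b : V) : R :=
  (prob p (PDEvent ends a₁ a₂ a₃ ∩ connEvent ends a₁ o) +
      prob p (PDEvent ends a₁ a₂ a₃ ∩ connEvent ends a₂ o)) *
    (massM2 p ends a₁ a₂ a₃ b + deltaT p ends a₁ a₂ a₃ b) -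
  prob p (PDEvent ends a₁ a₂ a₃) *
    expect p (fun ω => sShare p ends o a₂ a₃ (cluster ends ω a₁) *
      psi p ends a₂ a₃ b (cluster ends ω a₁) * (avoidAll ends a₁ {a₂, a₃}).indicator 1 ω)

/-- **`K`** `:= E[η(C₁) · (1_b(C₁) − (1 − 1_b(C₁)) β(C₁)); R]`: the weighted labelling deficit
(mine-2 §23 (12)). -/
noncomputable def Kterm (p : E → R) (ends : E → Sym2 V) (o a₁ a₂ a₃ b : V) : R :=
  expect p (fun ω => eta p ends o a₂ a₃ (cluster ends ω a₁) *
    (ind b (cluster ends ω a₁) -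
      (1 - ind b (cluster ends ω a₁)) * beta p ends a₂ b (cluster ends ω a₁)) *
    (avoidAll ends a₁ {a₂, a₃}).indicator 1 ω)

end Defs

section Towers

variable {V : Type*} {E : Type*} [Fintype E] [DecidableEq E] [Fintype V] [DecidableEq V]
  {R : Type*} [Field R] [LinearOrder R] [IsStrictOrderedRing R]

omit [Fintype E] [DecidableEq E] [Fintype V] in
/-- `P(PD, o ∈ C₂)` as `{C₁ ∈ univ, C₂ ∈ {o ∈ ·} ∩ {a₃ ∉ ·}, R}`. -/
lemma PDoH_event_eq (ends : E → Sym2 V) (o a₁ a₂ a₃ : V) :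
    clusterInEvent ends a₁ Set.univ ∩ clusterInEvent ends a₂ ({W | o ∈ W} ∩ {W | a₃ ∉ W}) ∩
        avoidAll ends a₁ {a₂, a₃} = PDEvent ends a₁ a₂ a₃ ∩ connEvent ends a₂ o := by
  have h := PD_event_eq ends a₁ a₂ a₃
  ext ω
  have key := Set.ext_iff.1 h ω
  simp only [clusterInEvent, Set.mem_inter_iff, Set.mem_setOf_eq, Set.mem_univ, true_and,
    mem_cluster, mem_connEvent] at key ⊢
  tauto

omit [Fintype E] [DecidableEq E] [Fintype V] in
/-- `T_{h→l} = P(PD, o ∈ C₂, b ∈ C₁)` as `{C₁ ∈ {b ∈ ·}, C₂ ∈ {o ∈ ·} ∩ {a₃ ∉ ·}, R}`. -/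
lemma Thl_event_eq (ends : E → Sym2 V) (o a₁ a₂ a₃ b : V) :
    clusterInEvent ends a₁ {W | b ∈ W} ∩ clusterInEvent ends a₂ ({W | o ∈ W} ∩ {W | a₃ ∉ W}) ∩
        avoidAll ends a₁ {a₂, a₃} =
      PDEvent ends a₁ a₂ a₃ ∩ connEvent ends a₂ o ∩ connEvent ends a₁ b := by
  have h := PD_event_eq ends a₁ a₂ a₃
  ext ω
  have key := Set.ext_iff.1 h ω
  simp only [clusterInEvent, Set.mem_inter_iff, Set.mem_setOf_eq, Set.mem_univ, true_and,
    mem_cluster, mem_connEvent] at key ⊢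
  tauto

omit [LinearOrder R] [IsStrictOrderedRing R] in
/-- Tower identity: `P(PD, o ∈ C₂) = E[q_o(C₁); R]` (light-first form of the heavy o-mass). -/
lemma tower_PDoH (p : E → R) (ends : E → Sym2 V) (o a₁ a₂ a₃ : V) :
    prob p (PDEvent ends a₁ a₂ a₃ ∩ connEvent ends a₂ o) =
      expect p (fun ω => q p ends a₂ a₃ o (cluster ends ω a₁) *
        (avoidAll ends a₁ {a₂, a₃}).indicator 1 ω) := by
  rw [← PDoH_event_eq, prob_clusterIn_inter_avoid_eq_expect p ends a₁ a₂ (X := {a₂, a₃})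
    (Finset.mem_insert_self a₂ {a₃})]
  unfold q
  simp only [Set.indicator_univ, Pi.one_apply, one_mul]

omit [LinearOrder R] [IsStrictOrderedRing R] in
/-- Tower identity: `T_{h→l} = P(PD, o ∈ C₂, b ∈ C₁) = E[1_b(C₁) q_o(C₁); R]`. -/
lemma tower_Thl (p : E → R) (ends : E → Sym2 V) (o a₁ a₂ a₃ b : V) :
    prob p (PDEvent ends a₁ a₂ a₃ ∩ connEvent ends a₂ o ∩ connEvent ends a₁ b) =
      expect p (fun ω => ind b (cluster ends ω a₁) * q p ends a₂ a₃ o (cluster ends ω a₁) *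
        (avoidAll ends a₁ {a₂, a₃}).indicator 1 ω) := by
  rw [← Thl_event_eq, prob_clusterIn_inter_avoid_eq_expect p ends a₁ a₂ (X := {a₂, a₃})
    (Finset.mem_insert_self a₂ {a₃})]
  rfl

omit [LinearOrder R] [IsStrictOrderedRing R] in
/-- `T_{l→h} − Δ_l = E[1_o(C₁) ψ(C₁); R]` (`Tlh_sub_deltaL` + the towers `tower_ob`, `tower_obT`). -/
lemma Xl_eq_expect (p : E → R) (ends : E → Sym2 V) (o a₁ a₂ a₃ b : V) :
    prob p (PDEvent ends a₁ a₂ a₃ ∩ connEvent ends a₁ o ∩ connEvent ends a₂ b) -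
        deltaL p ends o a₁ a₂ a₃ b =
      expect p (fun ω => ind o (cluster ends ω a₁) * psi p ends a₂ a₃ b (cluster ends ω a₁) *
        (avoidAll ends a₁ {a₂, a₃}).indicator 1 ω) := by
  rw [Tlh_sub_deltaL, tower_ob, tower_obT]
  unfold expect
  rw [← Finset.sum_sub_distrib]
  refine Finset.sum_congr rfl fun ω _ => ?_
  unfold psi
  ring

end Towers

section Pointwise

variable {V : Type*} {E : Type*} [Fintype E] [DecidableEq E] [Fintype V] [DecidableEq V]
  {R : Type*} [Field R] [LinearOrder R] [IsStrictOrderedRing R]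

omit [Fintype V] [DecidableEq V] in
/-- `0 ≤ q_o`. -/
lemma q_nonneg (p : E → R) (hp : IsProbVec p) (ends : E → Sym2 V) (o a₂ a₃ : V) (W : Set V) :
    0 ≤ q p ends a₂ a₃ o W :=
  delClusterProb_nonneg p hp ends a₂ _ W

omit [Fintype V] [DecidableEq V] in
/-- `q_o ≤ u` (the event `{o ∈ C(a₂), a₃ ∉ C(a₂)}` is contained in `{a₃ ∉ C(a₂)}`). -/
lemma q_le_u (p : E → R) (hp : IsProbVec p) (ends : E → Sym2 V) (o a₂ a₃ : V) (W : Set V) :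
    q p ends a₂ a₃ o W ≤ u p ends a₂ a₃ W := by
  unfold q u delClusterProb
  exact prob_mono hp fun ω hω => hω.2

omit [Fintype V] [DecidableEq V] in
/-- `u · η = q_o`, also when `u = 0` (then `q_o = 0` as `0 ≤ q_o ≤ u`). -/
lemma u_mul_eta (p : E → R) (hp : IsProbVec p) (ends : E → Sym2 V) (o a₂ a₃ : V) (W : Set V) :
    u p ends a₂ a₃ W * eta p ends o a₂ a₃ W = q p ends a₂ a₃ o W := by
  unfold eta
  by_cases hu : u p ends a₂ a₃ W = 0
  · have h0 : q p ends a₂ a₃ o W = 0 :=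
      le_antisymm ((q_le_u p hp ends o a₂ a₃ W).trans hu.le) (q_nonneg p hp ends o a₂ a₃ W)
    rw [hu, h0, zero_mul]
  · field_simp

omit [Fintype V] [DecidableEq V] [LinearOrder R] [IsStrictOrderedRing R] in
/-- `u · r = ψ` when `u ≠ 0`. -/
lemma u_mul_rRatio (p : E → R) (ends : E → Sym2 V) (a₂ a₃ b : V) {W : Set V}
    (hu : u p ends a₂ a₃ W ≠ 0) :
    u p ends a₂ a₃ W * rRatio p ends a₂ a₃ b W = psi p ends a₂ a₃ b W := by
  unfold rRatio
  field_simp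

omit [Fintype V] [DecidableEq V] in
/-- `q_o(W) = 0` when `o ∈ W` and `a₂ ∉ W` (every edge at `o` is closed in `G ∖ W`). -/
lemma q_eq_zero_of_mem (p : E → R) (hp : IsProbVec p) (ends : E → Sym2 V) {o a₂ a₃ : V}
    {W : Set V} (hoW : o ∈ W) (ha₂ : a₂ ∉ W) : q p ends a₂ a₃ o W = 0 := by
  have ho : o ≠ a₂ := fun h => ha₂ (h ▸ hoW)
  have hβ : beta p ends a₂ o W = 0 := beta_eq_zero_of_mem p ends ho hoW
  have h1 := q_le p hp ends a₂ a₃ o W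
  rw [hβ, mul_zero] at h1
  exact le_antisymm h1 (q_nonneg p hp ends o a₂ a₃ W)

omit [Fintype V] [DecidableEq V] in
/-- `η(W) = 0` when `o ∈ W` and `a₂ ∉ W`: mine-2's factor `1{o ∉ S}` in `η` is automatic on `R`. -/
lemma eta_eq_zero_of_mem (p : E → R) (hp : IsProbVec p) (ends : E → Sym2 V) {o a₂ a₃ : V}
    {W : Set V} (hoW : o ∈ W) (ha₂ : a₂ ∉ W) : eta p ends o a₂ a₃ W = 0 := by
  unfold eta
  rw [q_eq_zero_of_mem p hp ends hoW ha₂, zero_div]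

omit [Fintype V] [DecidableEq V] in
/-- `u · s = 1_o u + q_o` (pointwise, no positivity needed). -/
lemma u_mul_sShare (p : E → R) (hp : IsProbVec p) (ends : E → Sym2 V) (o a₂ a₃ : V) (W : Set V) :
    u p ends a₂ a₃ W * sShare p ends o a₂ a₃ W =
      ind o W * u p ends a₂ a₃ W + q p ends a₂ a₃ o W := by
  unfold sShare
  rw [mul_add, u_mul_eta p hp ends o a₂ a₃ W]
  ring

end Pointwise

section Moments

variable {V : Type*} {E : Type*} [Fintype E] [DecidableEq E] [Fintype V] [DecidableEq V]
  {R : Type*} [Field R] [LinearOrder R] [IsStrictOrderedRing R]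

omit [Fintype V] [DecidableEq V] [LinearOrder R] [IsStrictOrderedRing R] in
/-- Expectations against `1_S` only see the values on `S`. -/
lemma expect_congr_on {p : E → R} {S : Set (Config E)} {f g : Config E → R}
    (h : ∀ ω ∈ S, f ω = g ω) :
    expect p (fun ω => f ω * S.indicator 1 ω) = expect p (fun ω => g ω * S.indicator 1 ω) := by
  unfold expect
  refine Finset.sum_congr rfl fun ω _ => ?_
  dsimp only
  by_cases hω : ω ∈ S
  · rw [h ω hω]
  · simp [Set.indicator_of_notMem hω]

omit [Fintype V] [LinearOrder R] [IsStrictOrderedRing R] in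
/-- `E[s ψ; R] = E[1_o ψ; R] + E[η ψ; R]`. -/
lemma expect_sShare_psi (p : E → R) (ends : E → Sym2 V) (o a₁ a₂ a₃ b : V) :
    expect p (fun ω => sShare p ends o a₂ a₃ (cluster ends ω a₁) *
        psi p ends a₂ a₃ b (cluster ends ω a₁) * (avoidAll ends a₁ {a₂, a₃}).indicator 1 ω) =
      expect p (fun ω => ind o (cluster ends ω a₁) * psi p ends a₂ a₃ b (cluster ends ω a₁) *
          (avoidAll ends a₁ {a₂, a₃}).indicator 1 ω) +
        expect p (fun ω => eta p ends o a₂ a₃ (cluster ends ω a₁) *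
          psi p ends a₂ a₃ b (cluster ends ω a₁) * (avoidAll ends a₁ {a₂, a₃}).indicator 1 ω) := by
  rw [← expect_add]
  unfold expect
  refine Finset.sum_congr rfl fun ω _ => ?_
  simp only [Pi.add_apply]
  unfold sShare
  ring

/-- `D_o = P(PD, o ∈ C₁) + P(PD, o ∈ C₂) = E[u s; R]` (mine-2's `D_o = E[ũ s]`). -/
lemma expect_u_sShare (p : E → R) (hp : IsProbVec p) (ends : E → Sym2 V) (o a₁ a₂ a₃ : V) :
    expect p (fun ω => u p ends a₂ a₃ (cluster ends ω a₁) *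
        sShare p ends o a₂ a₃ (cluster ends ω a₁) * (avoidAll ends a₁ {a₂, a₃}).indicator 1 ω) =
      prob p (PDEvent ends a₁ a₂ a₃ ∩ connEvent ends a₁ o) +
        prob p (PDEvent ends a₁ a₂ a₃ ∩ connEvent ends a₂ o) := by
  rw [tower_PDo, tower_PDoH, ← expect_add]
  unfold expect
  refine Finset.sum_congr rfl fun ω _ => ?_
  simp only [Pi.add_apply]
  rw [u_mul_sShare p hp ends o a₂ a₃]
  ring

omit [LinearOrder R] [IsStrictOrderedRing R] in
/-- `W = E[u r; R]` when `u ≠ 0` on `R` (mine-2's `W_l = E[ũ r]`). -/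
lemma expect_u_rRatio (p : E → R) (ends : E → Sym2 V) (a₁ a₂ a₃ b : V)
    (hu : ∀ ω ∈ avoidAll ends a₁ {a₂, a₃}, u p ends a₂ a₃ (cluster ends ω a₁) ≠ 0) :
    expect p (fun ω => u p ends a₂ a₃ (cluster ends ω a₁) *
        rRatio p ends a₂ a₃ b (cluster ends ω a₁) * (avoidAll ends a₁ {a₂, a₃}).indicator 1 ω) =
      massM2 p ends a₁ a₂ a₃ b + deltaT p ends a₁ a₂ a₃ b := by
  rw [← Lambda.expect_psi_eq]
  exact expect_congr_on fun ω hω => u_mul_rRatio p ends a₂ a₃ b (hu ω hω)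

omit [Fintype V] [LinearOrder R] [IsStrictOrderedRing R] in
/-- `E[u s r; R] = E[s ψ; R]` when `u ≠ 0` on `R`. -/
lemma expect_u_sShare_rRatio (p : E → R) (ends : E → Sym2 V) (o a₁ a₂ a₃ b : V)
    (hu : ∀ ω ∈ avoidAll ends a₁ {a₂, a₃}, u p ends a₂ a₃ (cluster ends ω a₁) ≠ 0) :
    expect p (fun ω => u p ends a₂ a₃ (cluster ends ω a₁) *
        sShare p ends o a₂ a₃ (cluster ends ω a₁) * rRatio p ends a₂ a₃ b (cluster ends ω a₁) *
        (avoidAll ends a₁ {a₂, a₃}).indicator 1 ω) =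
      expect p (fun ω => sShare p ends o a₂ a₃ (cluster ends ω a₁) *
        psi p ends a₂ a₃ b (cluster ends ω a₁) * (avoidAll ends a₁ {a₂, a₃}).indicator 1 ω) := by
  refine expect_congr_on fun ω hω => ?_
  rw [← u_mul_rRatio p ends a₂ a₃ b (hu ω hω)]
  ring

end Moments

end LightFirst

end Summit.Ventures.PercRepro2
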